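import Summits.AtomisticToContinuum.HydrodynamicLimit.Theorems.CollisionIsometryCLTAdaptedWeightCLTTLStubDuhamel
import Summits.AtomisticToContinuum.HydrodynamicLimit.Theorems.CollisionIsometryCLTAdaptedWeightCLTTLStubFlowDictionary
import Summits.AtomisticToContinuum.HydrodynamicLimit.Theorems.CollisionIsometryCLTAdaptedWeightCLTTLStubReduction
import Summits.AtomisticToContinuum.HydrodynamicLimit.Theorems.CollisionIsometryCLTAdaptedWeightCLTTLColumnDepolarisationBalance
import Summits.AtomisticToContinuum.HydrodynamicLimit.Theorems.CollisionIsometryCLTAdaptedWeightCLTTLColumnDepolarisationRate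
import Summits.AtomisticToContinuum.HydrodynamicLimit.Theorems.CollisionIsometryCLTAdaptedWeightCLTTLPastDampingInput
import Summits.AtomisticToContinuum.HydrodynamicLimit.Theorems.CollisionIsometryCLTAdaptedWeightCLTTLSourceContractionIdentity

/-!
# Line `contact-source-duhamel` for the crux `AdaptedWeightCLT` (stmt-AtomisticToContinuum-14868,
  the rev-12 TIME-LOCAL form of ex stmt-12949; skeleton re-cut by the line lead 2026-08-16, see `## Re-cut`)

Route `CollisionIsometryCLT`, crux rank 2 (the route's hardest item), rev 12:
`∀ profiles ∃ σ₀ ∀ σ < σ₀ ∀ Φ, H1(σ,Φ) → ∀ kernels ∀ t > 0, H2(σ,Φ,t) → C(σ,Φ,t)` with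
H1 = the conclusion of `DiffuseBackwardInfluence` (mean inverse participation ratio of the
frozen-geometry velocity transfer `M` over every admissible kinetic window tends to `0`),
H2(t) = component (i) of `AprioriBoundsPreShock` at `t` (time-averaged one-particle exponential
velocity moment on `[0, t]`),
C(t) = the kinetic closure on `[0, t]` (the block traceless kinetic stress `D` and the block kinetic heat
flux `q` vanish in `L²([0,t] × 𝕋³)` in probability, `γ ≤ 1/15`).

## Re-cut (lead `prover-line-stmt-AtomisticToContinuum-14868-0`, 2026-08-16)
(1) TIME-LOCAL: every H2-consuming statement is sliced per horizon — `TailsOn … t` (the crux's per-`t`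
hypothesis verbatim), `PastSmallOn/CrossNullOn/SourceContractionOn … t`, `ConclOn … t` (the crux's
conclusion on `[0,t]`, its `let ρb mb ub D q` telescope verbatim), `CruxTailT` (the rev-12 tail verbatim);
stubs 4–7 read H2 per `t`; the composition goes through `cruxTailT_of_conclOn`; nothing else changes
(every stub's content already lived on `[0, t]`). (2) cdisprove `stub-misstated: stub_pastDamping`
(2026-08-16T06:12Z, certified by `Theorems/AdaptedWeightCLT/Negative/CubicProbeDeficiency.lean`): the six
`dirV` probes of `cd3` lie on `xyz = 0` and cannot control the heat-flux PAST; `CDAlongAt` now uses the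
cubic-unisolvent ten-direction functional `cd3x` (`udir`; `tpow_three_polarization`). (3) The importable
vocabulary is `Theorems/CollisionIsometryCLTAdaptedWeightCLTLine.lean` (objects) +
`Theorems/CollisionIsometryCLTAdaptedWeightCLTTimeLocal.lean` (these statements, namespace
`…Theorems.ContactSourceDuhamel.TimeLocal`); the rev-11 `…Statements.lean` no longer elaborates.

## The lever (crux idea `contact-source-duhamel`, triage r1: pass ×3; merged with
## `impulse-stress-contraction` = the provider of this line's `stub_columnDepolarisation`)

NO CLT. The Euler kinetic closure consumes only two polynomials of the peculiar velocities
`y = v − ū` — the traceless second moment `D` (rank 2) and the vector third moment `q` (rank 3) —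
and along a hard-sphere path the one-particle tensors `Y_i = y_i^{⊗r}` obey an EXACT inhomogeneous
LINEAR recursion collision by collision: at a collision `(i, j, n)`, `P = nnᵀ/|n|²`, `Q = 1 − P`,
`y_i⁺ = Q y_i + P y_j`, hence (binomial expansion)
  `Y_i⁺ = Q^{⊗r} Y_i + P^{⊗r} Y_j + S_c^{(i)}`,  `S_c^{(i)}` = the CROSS TERMS (≥ 1 factor of each of `Qy_i`, `Py_j`).
Iterating ("variation of constants", `stub_duhamel`): the block moment at time `s` is the INCOHERENT
(decoupled-power) transport `𝒯` of the window-start tensors plus the window sum of transported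
contact sources,
  `Σ_i w_i ⟨C, Y_i(s)⟩ = PAST + Ξ`,  `PAST = Σ_i w_i ⟨C, (𝒯_{0→m} Y(s−Δ))_i⟩`,
  `Ξ = Σ_{collisions c in the window} Σ_i w_i ⟨C, (𝒯_{c→m} S_c)_i⟩`.
* PAST is killed pathwise-in-geometry by COLUMN DEPOLARISATION of `𝒯` (rank 2: the forward impulse
  cloud's stress tends to `|a|²𝟙/3`, so traceless tests see nothing; rank 3: the cloud's cubic tensor
  tends to `0` — spin-1 suppression, which is what diffuseness pays for) plus the tails H2
  (`stub_columnDepolarisation` ⇐ H1 + one-step normal non-degeneracy; `stub_pastDamping`).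
* Ξ is compared with its CHAOS VALUE `Ξ^ch` (each source replaced by its average over an independent
  pair drawn from the `|g·n|`-weighted product of the block's current empirical velocity law, GIVEN the
  realised normal): `stub_contactCrossNull` (CCN) says `Ξ − Ξ^ch → 0` in `L²ₜ,ₓ` in probability — the
  Stosszahlansatz in its weakest moment form: bilinear/cubic, colliding pairs only, one memory back,
  equilibrium-exact (orthogonal Gaussian components are independent; no `O(σ³)` static defect).
* The chaos value is a RESTORING force: for a Gaussian local law `N(0, θ(𝟙+A))`,
  `E[(y_j·n̂) Q y_i | n̂, flux] = −(θ/2) Q A n̂` for EVERY `n̂`, so `⟨A, E S⟩ = −θ(|An̂|² − (n̂ᵀAn̂)²) ≤ 0`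
  (zero iff isotropic; identically zero without flux bias — the source's chaos value IS the adapted
  selection, priced rather than wished away); with the pulled-back tests depolarising along each
  particle's later collisions (mean `(3/5)^a`) the correlation of the chaos value with the current
  block moments is `≈ −½(|D|²+|q|²)`: `stub_sourceContraction` asks only `≤ κ(|D|²+|q|²) + o(1)` for
  some `κ < 1` — the line's CLOSURE statement and its openly named debt (hard-sphere moments do not
  close deterministically: the claim is along the flow, in probability).
* `stub_reduction` (measure theory): `|D|²+|q|² = Σ_b Blk_b (PAST_b + Ξ_b)
  ≤ 2ηΣBlk² + (4η)⁻¹Σ(PAST² + (Ξ−Ξ^ch)²) + Σ Blk·Ξ^ch`, so `(1 − κ − 2η)∫∫(|D|²+|q|²) ≤ o(1)` in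
  probability: C.
The line window is `Δℓ_N = (N+1)^{-1/3} log(N+2)` (`n_N ≍ σ² log N → ∞` collisions per particle,
`N^{3γ} Δℓ_N → 0` for every `γ ≤ 1/15`); for `s < Δℓ_N` the window has length `0` (no negative times:
there PAST is the block moment itself and the initial layer is priced by H2 inside `stub_pastDamping`).

## Composition (kernel-checked, sorry-free)
`AdaptedWeightCLT_of : stub_duhamel → stub_flowDictionary → stub_columnDepolarisation →
stub_pastDamping → stub_contactCrossNull → stub_sourceContraction → stub_reduction →
CollisionIsometryCLT.AdaptedWeightCLT` (D-0027 §3.3 shape: `def stub_x : Prop := type_of% Holds.stub_x`;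
`σ₀ := min (min σ_CD σ_CCN) (min σ_SC 2⁻¹)`; H1 enters `stub_columnDepolarisation` (and is offered to
CCN/SC), H2 on `[0,t]` enters `stub_pastDamping`, CCN, SC and the reduction at the same `t`; the crux's
`let M; let ipr` are this file's `transferSteps … (steps …)` / `iprF` by ζδ-reduction, its tail is
`CruxTailT` verbatim, fed from the per-horizon slices by `cruxTailT_of_conclOn`).

## Disproof used (`Cruxes/AdaptedWeightCLT/Disproof.lean`, cdisprove cycle 1: NO KILL)
§1 `adaptedWeightCLT_of_fastMomentRelaxation`, `withoutDiffuse/withoutTails_of_fastMomentRelaxation`: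
no `_false_without_` theorem exists; both hypotheses are nevertheless USED here (H1 at
`stub_columnDepolarisation`, H2 at `stub_pastDamping`/CCN/SC/reduction). §3 toys (landed as
`Theorems/AdaptedWeightCLT/Negative/MechanismToys.lean`, p73057): I1 `diffuse_rows_need_not_isotropise`
— honoured: isotropy is never inferred from `ipr`; it is the typed column depolarisation `cd2` of the
reflection-generated transport (the isoBlock rows are not reflection products: they violate
`Σ_k M_ik = 𝟙 = Σ_i M_ik`); I2 `adapted_unit_rows_need_not_centre` — honoured: no CLT/Lindeberg step is
run, adaptedness is kept exactly inside `Ξ` and priced by CCN at contact; S4 `one_reflection_covariance`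
(7/15 self, 2/15 partner) — these are the depolarisation constants behind `κ`; §2 `ipr_of_collisionCount_eq_zero`
— consistent: with no collisions `𝒯 = id`, no sources, PAST = the block moment, nothing is claimed.
No stub is an instance of a landed Negative lemma (all are statements along the local-Gibbs flow or
exact algebra).

## Cycle 1 (lead 14868-0, wave 1 of six workers + integration, 2026-08-16) — skeleton v2
LANDED through the gate (all `--supports stmt-14868`, namespace `…Theorems.ContactSourceDuhamel.TimeLocal.*`):
`stub_duhamel` (TLStubDuhamel, p98625), `stub_flowDictionary` (TLStubFlowDictionary, p108584),
`stub_reduction` (TLStubReduction p105415 over TLReductionDictionary/Bounds/Fold/Measurable/Flow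
p99975/p98969/p99455/p102245/p101445), the time-local vocabulary (TimeLocal p96227, TLPastDampingInput), and
helper layers of the open stubs (TLSourceContractionIdentity p98750; TLColumnDepolarisationPieces/Balance/
Rate/Bounds p101499/p101143/p101404/p102676, Floor pending; TLPastDampingAlgebra/DensityCap/Masses
p102175/p101559/p104637). This skeleton now IMPORTS them: stubs 1, 2, 7 are theorems, not sorries.
RESHAPED after two `stub-misstated` verdicts (workers + the standing disprover agree):
* `stub_columnDepolarisation`: H1 (`DiffuseAt`, coherent transfer) does not control the INCOHERENT transport
  — explicit recollision-tower witness with `iprF = 9/(N+1)` (the floor) and `cd2 → 0.0317 > 0` (worker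
  evidence `stub_columnDepolarisation_WITNESS_gadget4_floor.json`); the depolarisation balance
  `anisF m₂ = anisF m₁ − 2·workF + quadF` (landed, Balance) consumes exactly three typed inputs, now explicit
  hypotheses: `IncoherentDiffuseAt` (incoherent participation floor), `ManyCollisionsAt` (≥ K(N+1) steps in
  the second half-window ∀K), `OneStepNondegenerateAt` (OSN, integrated one-sided form) — all typed and landed
  in `…TimeLocal.ColumnDepolarisation`, asserted nowhere.
* `stub_pastDamping`: `CDAlongAt` bounds COLUMN sums while PAST pairs ROW-weighted sums; each fold step hands
  a `P`-part across `ε_N` in full (cradle relay, disprover's `Negative/StubPastDampingCloudRelay.lean`), so a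
  bound on the number of fold steps along the flow is needed: new per-horizon hypothesis `FewStepsOn … t`
  (TLPastDampingInput), asserted nowhere.
* The four conjectural inputs are bundled in ONE new stub `stub_inputs` (H1 → the three CD inputs; H1 ∧ H2 on
  [0,t] → FewStepsOn t), so that the skeleton states honestly what hard-sphere facts the line consumes.
STRUCTURAL FINDING (worker audit of `stub_sourceContraction`, certified in TLSourceContractionIdentity:
`xiCorr_eq`, `abs_xiCorr_sub_defectSq_le`, `sc_event_of_defect_gt`, `defect_gt_or_of_sc_event`; and the
disprover's `Negative/StubContactCrossNullClosureDebt.lean`): by the exact identity `XiCorr = DefectSq −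
ΣBlk·PAST − ΣBlk·(Ξ−Ξ^ch)`, GIVEN `PastSmallOn ∧ CrossNullOn` the statement `SourceContractionOn t` (any κ < 1)
is EQUIVALENT to the crux's conclusion `ConclOn t`; its only intended proof (the restoring-force evaluation
of Ξ^ch from the block LAW) needs near-Gaussian block laws along the flow, which is MORE than the
conclusion. So stub 6 is crux-sized: the line relocates the crux into it rather than reducing it. Likewise the
ABSOLUTE `CrossNullOn` is conclusion-strength at fixed σ (static relative chaos defect c(σ) = O(σ³) ≠ 0,
disprover kit j017633/j017766: −8 % at φ = 0.05); only a RELATIVE form has independent content.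
-/

namespace Summit.AtomisticToContinuum.HydrodynamicLimit.Cruxes.AdaptedWeightCLT.ContactSourceDuhamel

open scoped BigOperators Topology Classical MeasureTheory ENNReal InnerProductSpace
open Filter Set MeasureTheory
open Summit.AtomisticToContinuum.HydrodynamicLimit.Theorems.ContactSourceDuhamel
open Summit.AtomisticToContinuum.HydrodynamicLimit.Theorems.ContactSourceDuhamel.TimeLocal
open Summit.AtomisticToContinuum.HydrodynamicLimit.Theorems.ContactSourceDuhamel.TimeLocal.ColumnDepolarisation

noncomputable section

/-! ## Registered stubs (`Holds.stub_*`; the open ones have body `sorry`, the closed ones are the landed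
theorems — vocabulary = `Theorems/CollisionIsometryCLTAdaptedWeightCLTLine.lean` (objects) +
`…TimeLocal.lean`, `…TLPastDampingInput.lean`, `…TLColumnDepolarisationBalance/Rate.lean` (statements)) -/

namespace Holds

/-- STUB 1 (VARIATION OF CONSTANTS) — CLOSED: `TimeLocal.Duhamel.stub_duhamel` (TLStubDuhamel.lean, p98625). -/
theorem stub_duhamel : ∀ σ : ℝ, DuhamelIdentity σ :=
  Duhamel.stub_duhamel

/-- STUB 2 (FLOW DICTIONARY) — CLOSED: `TimeLocal.FlowDict.stub_flowDictionary` (TLStubFlowDictionary.lean). -/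
theorem stub_flowDictionary : ∀ σ : ℝ, 0 < σ → σ < 2⁻¹ → FlowDictionary σ :=
  FlowDict.stub_flowDictionary

/-- STUB 8 (INPUTS — the conjectural hard-sphere facts the line consumes beyond H1/H2, bundled; NEW in v2,
OPEN, no proof route claimed). For all nice profiles there is `σ₀ > 0` such that for `0 < σ < σ₀` and every
flow family with diffuse rows (H1): (a) `IncoherentDiffuseAt` — the INCOHERENT transport delocalises too
(carrier participation of the impulse clouds + collision-integrated pair participation over the second
half-window → 0 in mean; equals H1 on forest windows, differs by interference terms in general — the
recollision-tower witness shows H1 alone does not give it); (b) `ManyCollisionsAt` — for every `K` the fold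
performs ≥ `K(N+1)` steps in the second half of the line window w.h.p. (physically `≍ (N+1)σ² log N`;
H1 forces only ≳ 3/2 reflections per particle); (c) `OneStepNondegenerateAt` — one-step non-degeneracy of the
collision normals/pairs against the carried tensors, integrated one-sided form with some `c₀ > 0` (holds
with any `c₀ < 4/5` for uniform independent normals and fair pairs; fails for planar/coordinate/adapted normal
laws); (d) for every horizon `t > 0` with H2 on `[0,t]`: `FewStepsOn … t` — `∫₀ᵗ #steps ds = o((N+1)^{19/15})`
in probability (physically `≍ t(N+1)σ²√θ log N`; an a-priori collision-count bound along the non-equilibrium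
law, not derivable from H2's velocity moments: collision rates depend on microscopic gaps). Why it might
fail: (a)–(c) are chaotic-hypothesis-type statements along the local-Gibbs flow at fixed σ (the sibling
crux's `share-nondegeneracy-one-flight` territory); (d) needs a tail bound on collision counts whose cheap
macrostates (rattling dense clusters) are only polynomially rare under the invariant law, so entropy
transfer (FrostBudget + KipnisLandim A1.8.2) does not reach it. -/
theorem stub_inputs :
    ∀ (a₀ θ₀ : T3 → ℝ) (u₀ : T3 → V3), NiceProfiles a₀ θ₀ u₀ →
      ∃ σ₀ : ℝ, 0 < σ₀ ∧ ∀ σ : ℝ, 0 < σ → σ < σ₀ → ∀ Φ : Flows σ, DiffuseAt σ a₀ θ₀ u₀ Φ →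
        (IncoherentDiffuseAt σ a₀ θ₀ u₀ Φ ∧ ManyCollisionsAt σ a₀ θ₀ u₀ Φ ∧
            OneStepNondegenerateAt σ a₀ θ₀ u₀ Φ) ∧
          ∀ t : ℝ, 0 < t → TailsOn σ a₀ θ₀ u₀ Φ t → FewStepsOn σ a₀ θ₀ u₀ Φ t := by
  sorry

/-- STUB 3 (COLUMN DEPOLARISATION — RESHAPED in v2 after `stub-misstated`; size L; the worker's proof
route is written in `TLColumnDepolarisationFloor.lean`'s docstring). For all nice profiles there is `σ₀ > 0`
such that for `0 < σ < σ₀` and every flow family: H1 (kept for interface compatibility; unused by the intended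
proof), incoherent diffuseness, many collisions and one-step non-degeneracy imply `E_LG[cd2 + cd3x] → 0` along
the line window at every `t > 0`. Route: the exact balance `anisF m₂ = anisF m₁ − 2·workF(m₁,m₂) + quadF(m₁,m₂)`
(landed, `…Balance`), OSN on the last `K(N+1)` steps with `K > 7/(2c₀δ)` ⇒ some `s*` there with
`anisF s* < δ(N+1)`-normalised; balance on `[s*, m)` + OSN + `quadF ≤ ½ pairPartF` (Floor) ⇒
`cd2 ≤ δ + 2·osnErr + ½·pairPartF(second half)`; `cd3x ≤ 3·carrPartF` (Floor); `ManyCollisionsAt` puts the last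
`K(N+1)` steps inside the second half-window; bounds `0 ≤ cd2 ≤ 6`, `0 ≤ cd3x ≤ 78` (landed, `…Bounds`) for
the passage from "in probability" to "in mean". Why it might fail: bookkeeping only, given its four
hypotheses (measurability of the fold functionals in `z` is in `TLReductionMeasurable.lean`). -/
theorem stub_columnDepolarisation :
    ∀ (a₀ θ₀ : T3 → ℝ) (u₀ : T3 → V3), NiceProfiles a₀ θ₀ u₀ →
      ∃ σ₀ : ℝ, 0 < σ₀ ∧ ∀ σ : ℝ, 0 < σ → σ < σ₀ →
        ∀ Φ : Flows σ, DiffuseAt σ a₀ θ₀ u₀ Φ → IncoherentDiffuseAt σ a₀ θ₀ u₀ Φ →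
          ManyCollisionsAt σ a₀ θ₀ u₀ Φ → OneStepNondegenerateAt σ a₀ θ₀ u₀ Φ →
            CDAlongAt σ a₀ θ₀ u₀ Φ := by
  sorry

/-- STUB 4 (PAST DAMPING — RESHAPED in v2 after `stub-misstated`; analysis, size L). For nice profiles,
`0 < σ < 1/2` and every flow family: column depolarisation along `Δℓ` and, for a horizon `t > 0`, the tails
H2 on `[0, t]` AND the fold-step count bound `FewStepsOn … t` imply `∫₀ᵗ∫ₓ Σ_tests PAST² → 0` in probability
for every admissible kernel family. The planner's sketch (site decomposition `pastF_eq_sum_sites`,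
tracelessness `pairT_C2_iso2`, rank-2/3 polarisation over `dirV`/`udir` — landed, `…Algebra`; hard-core
density cap — landed, `…DensityCap`; doubly-stochastic carrier masses — landed, `…Masses`; velocity cutoff +
H2; dominated convergence in `s` from `CDAlongAt ∀ t` with `cd2 ≤ 6`, `cd3x ≤ 270`) closes on paper at every
interface once the cloud-locality/transport term `≲ 6c N^{γ} ε_N (N+1)⁻¹ #steps` is paid by `FewStepsOn`
(worker evidence `PastDampingMisstated.lean`; disprover's `cradle_relay`). Why it might fail: bookkeeping
(Bochner measurability/integrability of the fold functionals along the flow — available from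
`TLReductionMeasurable/Flow.lean`). -/
theorem stub_pastDamping :
    ∀ (a₀ θ₀ : T3 → ℝ) (u₀ : T3 → V3), NiceProfiles a₀ θ₀ u₀ →
      ∀ σ : ℝ, 0 < σ → σ < 2⁻¹ → ∀ Φ : Flows σ, CDAlongAt σ a₀ θ₀ u₀ Φ →
        ∀ t : ℝ, 0 < t → TailsOn σ a₀ θ₀ u₀ Φ t → FewStepsOn σ a₀ θ₀ u₀ Φ t →
          PastSmallOn σ a₀ θ₀ u₀ Φ t := by
  sorry

/-- STUB 5 (CONTACT CROSS NULL — the chaos residue; LOAD-BEARING, hardest, size XL; TIME-LOCAL). For all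
nice profiles there is `σ₀ > 0` such that for `0 < σ < σ₀`, every flow family and every horizon `t > 0` (H1,
and H2 on `[0, t]`, offered as hypotheses): along the line window, on `[0, t]`, the window source sums `Ξ` of both channels differ from their
chaos values `Ξ^ch` — every contact source `crossT r (Q yᵢ) (P yⱼ)` replaced by its average over an
independent pair drawn from the `|g·n|`-weighted product of the block's current empirical (shifted)
velocity law GIVEN the realised normal `n` (`chaosCross`) — by `o(1)` in `L²([0,t] × 𝕋³)` in
local-Gibbs probability. This is bilinear (rank 2) / cubic (rank 3) PRE-COLLISIONAL FACTORISATION AT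
CONTACT, for colliding pairs only, block × window averaged, with the fluctuation (variance) part of the
source sum INCLUDED (triage r1-1 (a)): `|B| n_N` summands of weight `1/|B|`, damped by the pulled-back
tests to an effective `O(1)` per particle, so the `L²` statement needs decorrelation ACROSS particles'
contacts, never fairness of one particle's successive kicks. Why easier than ancestor chaos (the card's
Transfer (v)): the pulled-back tests die after `O(1/c₀)` own collisions, so only the last `O(1)`
contacts of each block particle carry weight — the backward history that can correlate a weighted
colliding pair has depth `O(1)` in collision count, N-uniformly; the Euler factor `N^{1/3}` never
enters. Equilibrium-exact: under the invariant Gibbs law orthogonal Gaussian components are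
independent, `E[crossT] = 0 = chaosCross + O(N^{-(1−3γ)/2})`, no `O(σ³)` static defect. Why it might
fail: it IS a Stosszahlansatz-class statement along the non-equilibrium law at fixed `σ` for all
`t > 0` (`BoltzmannHypothesisBarrierNarrow` scope (b): absence of proof, not a counter-theorem) with
two named enemies — (1) RINGS closing within the depolarisation memory (an `O(σ³)`-probability stratum
per contact; its `SO(3)`-equivariant part renormalises the source coefficient, hence `∃ σ₀`), and
(2) SUB-BLOCK COHERENCE (triage r1-2 (F2), r1-3): a mesoscale shear/sound mode at scales
`N^{-1/3} ≪ ℓ ≪ N^{-γ}` makes the block law the wrong comparison (contact pairs share position, the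
block law carries the sub-block velocity variance as apparent anisotropy) and CCN then fails by `O(A²)`
deterministically — so the proof needs sub-block quiescence along the flow (`GermanoSplitLES.MesoQuiescence`,
stmt-9198, typed PRE-SHOCK only; post-shock nobody has a handle: this is the crux's own `∀ t > 0`
exposure, triage crux-level note 1). Tools: BBGKY/pseudo-trajectory expansion over `O(1)` collision
depths at fixed `σ` (GST2013 Part II for the combinatorics; recollision strata
`RecollisionGeometry.measure_setOf_ray_meets_closedBall_le`), H2 for uniform integrability of the
flux weight, Lutsko1996/2001 (doi:10.1103/physrevlett.77.2225, 10.1103/physrevlett.86.3344) for the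
Enskog-level evidence that pre-collisional factorisation survives strong shear. -/
theorem stub_contactCrossNull :
    ∀ (a₀ θ₀ : T3 → ℝ) (u₀ : T3 → V3), NiceProfiles a₀ θ₀ u₀ →
      ∃ σ₀ : ℝ, 0 < σ₀ ∧ ∀ σ : ℝ, 0 < σ → σ < σ₀ →
        ∀ Φ : Flows σ, DiffuseAt σ a₀ θ₀ u₀ Φ →
          ∀ t : ℝ, 0 < t → TailsOn σ a₀ θ₀ u₀ Φ t → CrossNullOn σ a₀ θ₀ u₀ Φ t := by
  sorry

/-- STUB 6 (SOURCE CONTRACTION — the closure statement; size L/XL; TIME-LOCAL). For all nice profiles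
there is `σ₀ > 0` such that for `0 < σ < σ₀`, every flow family and every horizon `t > 0` (H1, and H2 on
`[0, t]`, offered): for every admissible kernel family some `κ < 1` bounds the correlation of the chaos value of the source sums with the
current block moments, `∫₀ᵗ∫ₓ Σ_b Blk_b Ξ^ch_b ≤ κ ∫₀ᵗ∫ₓ (|D|²+|q|²) + o(1)` in probability.
Why plausible — the chaos value is a RESTORING FORCE, so the predicted constant is NEGATIVE:
(i) per collision, for a Gaussian block law `N(0, θ(𝟙+A))` and EVERY normal `n̂`,
`chaosCross 2 = −(θ/2)(QAn̂ ⊗ n̂ + n̂ ⊗ QAn̂)` exactly (flux bias `E[(yᵢ·n̂)(yⱼ·n̂) | flux] = −θ_n̂/2`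
times Gaussian conditioning `E[Qyᵢ | yᵢ·n̂] = θQAn̂ (yᵢ·n̂)/θ_n̂`; triage-checked, toy j008832:
`nn = −0.50`, `src·A/‖A‖² ≈ −0.4θ` per pair), hence `⟨A, E S^{(i)}⟩ = −θ(|An̂|² − (n̂ᵀAn̂)²) ≤ 0`
for every `n̂`, `= −(θ/5)‖A‖²` on average (`E[QAn̂ ⊗ n̂] = A/5`) — zero iff isotropic, and with NO
flux bias (blind partners) it would vanish identically: the cross source's chaos value is pure
adaptedness, priced instead of wished away; `chaosCross 3 = 0` for every Gaussian law (the cubic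
value is linear in the ODD cumulants, i.e. in `q` at first order); (ii) memory: the pulled-back test
of a source of age `a` own-collisions has MEAN `E[QCQ + PCP]^a = (3/5)^a C` (7/15 kept + 2/15 handed
back through the partner's test, `one_reflection_covariance`, Disproof S4), so in normal-averaged
bookkeeping `Σ_b Blk_b Ξ^ch_b ≈ −(1/5)Σ_a (3/5)^a ⟨D(s), D(s_a)⟩ ≈ −½|D|²` on persistent
configurations (kernel mass `(1/5)/(1 − 3/5) = 1/2`), i.e. `κ ≈ −1/2`, while on relaxing
configurations both sides are `o(1)`; first-order feedback of the ambient anisotropy into the weights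
cancels (`c₁ = 0`, the sibling card's 6th-moment identity), so the kernel is the linearised hard-sphere
`ℓ = 2, 3` relaxation (`hardSphereLinearizedOp_spectralGap_holds` in tree). The UNSIGNED variant
`∫∫Σ(Ξ^ch)² ≤ κ²∫∫(|D|²+|q|²) + o(1)` also closes the reduction but has no margin: Cauchy–Schwarz with
the realised (un-averaged) weights gives rms memory `Σ_a (3/5)^{a/2} ≈ 4.4` times coefficient
`≈ 0.32`, above `1` — the sign is the lever, not the size. Why it might fail — this stub carries the
line's CLOSURE DEBT, stated openly: (1) the hard-sphere moment hierarchy does not close: a block law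
with `D = 0` but an anisotropic FOURTH cumulant has a non-zero flux cross moment (half the mass at
`±a e₁`, half uniform on the circle of radius `√2·a` in `e₁^⊥`: second moments isotropic,
`chaosCross 2 = λ·diag(2,−1,−1) ≠ 0` by `ℤ₂ × O(2)`-equivariance), so no DETERMINISTIC inequality of
this kind holds and the stub is claimed only ALONG THE FLOW, in probability, with `o(1)` slack —
hidden (higher-cumulant, flux-weighted) anisotropy must stay subordinate to the visible one or be
`o(1)` in `L²ₜ,ₓ`; for Maxwell molecules there is no such debt (IkenberryTruesdell1956), for hard
spheres it is the price of "moments, no entropy" (CarlenCarvalhoLoss2014 pay it with a spectral gap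
in `L²`); (2) the weights' orientation fluctuations (mean zero, `O(1)` per particle) must average out
across the block's particles (an LLN over distinct particles' distinct contacts — weak dependence,
never fairness of one particle's kicks) and the ADAPTED normal statistics renormalise `1/5`, `3/5`
(flux selection carries another quarter of the hard-sphere deviator rate, triage r1-1) — the margin
from `−1/2` to `1` is what absorbs both; (3) time variation of `D` within the memory (`O(1)` collision
times) enters through `⟨D(s), D(s_a)⟩`: an oscillation of `D` on the collision time scale would weaken
the sign (delay-equation effect), but the kernel mass `1/2 < 1` closes even unsigned in mean. Sources:
IkenberryTruesdell1956 (doi:10.1512/iumj.1956.5.55001), Cercignani1988 App. (A.2),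
CarlenGeronimoLoss2008 (doi:10.1137/070695423), CarlenCarvalhoLoss2014
(doi:10.1016/j.jfa.2013.08.024), GarzoSantos2003 (USF anisotropy `∝ Kn`, Disproof §6). -/
theorem stub_sourceContraction :
    ∀ (a₀ θ₀ : T3 → ℝ) (u₀ : T3 → V3), NiceProfiles a₀ θ₀ u₀ →
      ∃ σ₀ : ℝ, 0 < σ₀ ∧ ∀ σ : ℝ, 0 < σ → σ < σ₀ →
        ∀ Φ : Flows σ, DiffuseAt σ a₀ θ₀ u₀ Φ →
          ∀ t : ℝ, 0 < t → TailsOn σ a₀ θ₀ u₀ Φ t → SourceContractionOn σ a₀ θ₀ u₀ Φ t := by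
  sorry

/-- STUB 7 (REDUCTION, measure theory) — CLOSED: `TimeLocal.Reduction.stub_reduction`
(TLStubReduction.lean, p105415, over TLReductionDictionary/Bounds/Fold/Measurable/Flow). -/
theorem stub_reduction :
    ∀ σ : ℝ, 0 < σ → σ < 2⁻¹ → DuhamelIdentity σ → FlowDictionary σ →
      ∀ (a₀ θ₀ : T3 → ℝ) (u₀ : T3 → V3), NiceProfiles a₀ θ₀ u₀ → ∀ Φ : Flows σ,
        ∀ t : ℝ, 0 < t → TailsOn σ a₀ θ₀ u₀ Φ t → PastSmallOn σ a₀ θ₀ u₀ Φ t →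
          CrossNullOn σ a₀ θ₀ u₀ Φ t → SourceContractionOn σ a₀ θ₀ u₀ Φ t →
            ConclOn σ a₀ θ₀ u₀ Φ t :=
  Reduction.stub_reduction

end Holds

/-! ## Stub statements by name (D-0027 §3.3: the hypotheses of `_of` are the OPEN stubs) -/

/-- Statement of registered stub 8 (`Holds.stub_inputs`), by name. -/
def stub_inputs : Prop := type_of% Holds.stub_inputs
/-- Statement of registered stub 3 (`Holds.stub_columnDepolarisation`), by name. -/
def stub_columnDepolarisation : Prop := type_of% Holds.stub_columnDepolarisation
/-- Statement of registered stub 4 (`Holds.stub_pastDamping`), by name. -/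
def stub_pastDamping : Prop := type_of% Holds.stub_pastDamping
/-- Statement of registered stub 5 (`Holds.stub_contactCrossNull`), by name. -/
def stub_contactCrossNull : Prop := type_of% Holds.stub_contactCrossNull
/-- Statement of registered stub 6 (`Holds.stub_sourceContraction`), by name. -/
def stub_sourceContraction : Prop := type_of% Holds.stub_sourceContraction

/-! ## Composition (sorry-free): the open stubs + the landed theorems ⟹ the crux BY NAME -/

/-- **The skeleton theorem, v2.** `σ₀ := min (min σ_IN σ_CD) (min (min σ_CCN σ_SC) 2⁻¹)`. For `σ < σ₀`
and a flow family `Φ`, after introducing the crux's `let M; let ipr` and H1 (= `DiffuseAt` by ζδ-reduction),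
the goal is `CruxTailT σ a₀ θ₀ u₀ Φ` verbatim; by `cruxTailT_of_conclOn` it suffices to give, for every
horizon `t > 0` with H2 on `[0, t]`, the conclusion on `[0, t]`: the LANDED reduction (stub 7) is fed the
landed algebra (stub 1), the landed dictionary (stub 2), H2 at `t`, past damping at `t` (stub 4 — fed column
depolarisation from stub 3, itself fed H1 and the three CD inputs of stub 8, then H2 and `FewStepsOn t` from
stub 8), CCN at `t` (stub 5) and source contraction at `t` (stub 6). -/
theorem AdaptedWeightCLT_of
    (h8 : stub_inputs) (h3 : stub_columnDepolarisation) (h4 : stub_pastDamping)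
    (h5 : stub_contactCrossNull) (h6 : stub_sourceContraction) :
    Summit.AtomisticToContinuum.HydrodynamicLimit.Theses.CollisionIsometryCLT.AdaptedWeightCLT := by
  intro a₀ θ₀ u₀ ha hθ hu ha0 hθ0
  have hP : NiceProfiles a₀ θ₀ u₀ := ⟨ha, hθ, hu, ha0, hθ0⟩
  obtain ⟨σ₈, hσ₈, H8⟩ := (h8 : type_of% Holds.stub_inputs) a₀ θ₀ u₀ hP
  obtain ⟨σ₃, hσ₃, H3⟩ := (h3 : type_of% Holds.stub_columnDepolarisation) a₀ θ₀ u₀ hP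
  have H4 := (h4 : type_of% Holds.stub_pastDamping)
  obtain ⟨σ₅, hσ₅, H5⟩ := (h5 : type_of% Holds.stub_contactCrossNull) a₀ θ₀ u₀ hP
  obtain ⟨σ₆, hσ₆, H6⟩ := (h6 : type_of% Holds.stub_sourceContraction) a₀ θ₀ u₀ hP
  refine ⟨min (min σ₈ σ₃) (min (min σ₅ σ₆) 2⁻¹), ?_, ?_⟩
  · exact lt_min (lt_min hσ₈ hσ₃) (lt_min (lt_min hσ₅ hσ₆) (by norm_num))
  intro σ hσ hlt
  have h8lt : σ < σ₈ := lt_of_lt_of_le hlt ((min_le_left _ _).trans (min_le_left _ _))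
  have h3lt : σ < σ₃ := lt_of_lt_of_le hlt ((min_le_left _ _).trans (min_le_right _ _))
  have h5lt : σ < σ₅ :=
    lt_of_lt_of_le hlt ((min_le_right _ _).trans ((min_le_left _ _).trans (min_le_left _ _)))
  have h6lt : σ < σ₆ :=
    lt_of_lt_of_le hlt ((min_le_right _ _).trans ((min_le_left _ _).trans (min_le_right _ _)))
  have hhalf : σ < 2⁻¹ := lt_of_lt_of_le hlt ((min_le_right _ _).trans (min_le_right _ _))
  intro M ipr Φ hH1
  have hD : DiffuseAt σ a₀ θ₀ u₀ Φ := hH1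
  obtain ⟨⟨hID, hMC, hOSN⟩, hFew⟩ := H8 σ hσ h8lt Φ hD
  have hCD : CDAlongAt σ a₀ θ₀ u₀ Φ := H3 σ hσ h3lt Φ hD hID hMC hOSN
  show CruxTailT σ a₀ θ₀ u₀ Φ
  refine cruxTailT_of_conclOn fun t ht hT => ?_
  exact Holds.stub_reduction σ hσ hhalf (Holds.stub_duhamel σ) (Holds.stub_flowDictionary σ hσ hhalf)
    a₀ θ₀ u₀ hP Φ t ht hT
    (H4 a₀ θ₀ u₀ hP σ hσ hhalf Φ hCD t ht hT (hFew t ht hT))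
    (H5 σ hσ h5lt Φ hD t ht hT) (H6 σ hσ h6lt Φ hD t ht hT)

/-- D-0027 §3.3 shape: the crux from the registered open stubs — an `example`, so that
`AdaptedWeightCLT_of` stays the unique theorem concluding the crux. -/
example : Summit.AtomisticToContinuum.HydrodynamicLimit.Theses.CollisionIsometryCLT.AdaptedWeightCLT :=
  AdaptedWeightCLT_of Holds.stub_inputs Holds.stub_columnDepolarisation Holds.stub_pastDamping
    Holds.stub_contactCrossNull Holds.stub_sourceContraction

end

end Summit.AtomisticToContinuum.HydrodynamicLimit.Cruxes.AdaptedWeightCLT.ContactSourceDuhamel
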